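import Summits.QuantumAdvantage.AdviceFreeQNC0.BlockParityTarget
import HarnessLib

/-!
# Cell qa-qnc0 (rung F-Q2-odd, `p = 3`): LEMMA S for a WIN event — three hypothesis parities (ROUND-15 §3.6 (a)–(d))

Planner qa-qnc0-p1 g16, `ROUND-15.md` §3.6, for THEOREM A `BShotDWB3` (the B-shot law).  The structured endgame for the
win indicator: with the target translation `τ(p(c)) = t₀ + Σ_j η_j(−1)^{p_j(c)}` and three `0/1`-valued hypothesis
polynomials `F_t` (`t ∈ 𝔽₃`) of degree `≤ D` such that at most two of them fire at every point (`chargePair`),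
`Σ_t #{c : F_t(c) = 1 ∧ τ(p(c)) = t} ≤ 2^{Kℓ}·(2/3 + (4/3)·2^{−K} + 6·2^K·D/√ℓ)` (`sum_three_le`).

* `sum_ind_mul_tau_le` — the per-`t` bound `Σ_c [F c = u]·[τ = t] ≤ (2^K+2)/(3·2^K)·#{F = u} + 2^K·2D·2^{Kℓ}/√ℓ`
  (Walsh expansion over the parity bits, `abs_signed_corr_le`, `three_mul_card_tau_le` — the proof of LEMMA S with the
  two roles of `t` separated);
* `sum_three_le` — summing over `t` with the pointwise budget `Σ_t [F_t = 1] ≤ 2`.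

WHAT THIS IS NOT: no statement about the D-walk; separation NOT moved.
-/

noncomputable section

namespace Summit.QuantumAdvantage.AdviceFreeQNC0

namespace BlockParity

open Finset
open Literature.Computability.MetaComplexity Literature.Computability.MetaComplexity.Smolensky

variable {K ℓ : ℕ}

/-- **Per-`t` bound** (Walsh expansion + Smolensky): for `F` of degree `≤ D` and any `u, t ∈ 𝔽₃`,
`Σ_c [F c = u]·[τ(p(c)) = t] ≤ (2^K+2)/(3·2^K)·#{F = u} + 2^K·(2D·2^{Kℓ}/√ℓ)`. -/
theorem sum_ind_mul_tau_le (hℓ : 1 ≤ ℓ) (t₀ : ZMod 3) (η : Fin K → ZMod 3) (hη : ∀ j, η j ≠ 0)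
    {D : ℕ} {F : CubeFn (ZMod 3) (K * ℓ)} (hF : F ∈ lowDeg (ZMod 3) (K * ℓ) D) (u t : ZMod 3) :
    ∑ c : Fin (K * ℓ) → Bool, (if F c = u then (1 : ℝ) else 0) *
    (if tau t₀ η (bpar (ℓ := ℓ) c) = t then 1 else 0) ≤
    (2 ^ K + 2) / (3 * 2 ^ K) * ((univ.filter fun c : Fin (K * ℓ) → Bool => F c = u).card : ℝ) +
      (2 : ℝ) ^ K * (2 * D * (2 : ℝ) ^ (K * ℓ) / Real.sqrt ℓ) := by
  set f : (Fin K → Bool) → ℝ := fun q => if tau t₀ η q = t then 1 else 0 with hf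
  have hf01 : ∀ q, 0 ≤ f q ∧ f q ≤ 1 := fun q => by rw [hf]; dsimp only; split_ifs <;> norm_num
  -- expand
  have hexp : ∑ c : Fin (K * ℓ) → Bool, (if F c = u then (1 : ℝ) else 0) *
      (if tau t₀ η (bpar (ℓ := ℓ) c) = t then 1 else 0) =
      (1 / (2 : ℝ) ^ K) * ∑ a : Fin K → Bool, (∑ q, f q * CubeDistr.chi a q) *
        ∑ c : Fin (K * ℓ) → Bool, (if F c = u then (1 : ℝ) else 0) * CubeDistr.chi a (bpar (ℓ := ℓ) c) := by
    calc ∑ c : Fin (K * ℓ) → Bool, (if F c = u then (1 : ℝ) else 0) *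
          (if tau t₀ η (bpar (ℓ := ℓ) c) = t then 1 else 0)
        = ∑ c : Fin (K * ℓ) → Bool, (if F c = u then (1 : ℝ) else 0) *
            ((1 / (2 : ℝ) ^ K) * ∑ a : Fin K → Bool, (∑ q, f q * CubeDistr.chi a q) *
              CubeDistr.chi a (bpar (ℓ := ℓ) c)) := by
          refine Finset.sum_congr rfl fun c _ => ?_
          have hw := walsh_inversion f (bpar (ℓ := ℓ) c)
          rw [hf] at hw
          simp only at hw
          rw [hw]
      _ = (1 / (2 : ℝ) ^ K) * ∑ a : Fin K → Bool, (∑ q, f q * CubeDistr.chi a q) *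
            ∑ c : Fin (K * ℓ) → Bool, (if F c = u then (1 : ℝ) else 0) * CubeDistr.chi a (bpar (ℓ := ℓ) c) := by
          rw [Finset.mul_sum]
          simp only [Finset.mul_sum]
          rw [Finset.sum_comm]
          refine Finset.sum_congr rfl fun a _ => Finset.sum_congr rfl fun c _ => by ring
  rw [hexp]
  -- split off the trivial character
  rw [← Finset.add_sum_erase _ _ (mem_univ (fun _ : Fin K => false))]
  have hmain : (∑ q, f q * CubeDistr.chi (fun _ : Fin K => false) q) *
      ∑ c : Fin (K * ℓ) → Bool, (if F c = u then (1 : ℝ) else 0) * CubeDistr.chi (fun _ : Fin K => false) (bpar (ℓ := ℓ) c)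
      ≤ (2 ^ K + 2) / 3 * ((univ.filter fun c : Fin (K * ℓ) → Bool => F c = u).card : ℝ) := by
    simp only [chi_zero, mul_one]
    have hA : ∑ q, f q = ((univ.filter fun q : Fin K → Bool => tau t₀ η q = t).card : ℝ) := by
      rw [natCast_card_filter]
    have hB : ∑ c : Fin (K * ℓ) → Bool, (if F c = u then (1 : ℝ) else 0) =
        ((univ.filter fun c : Fin (K * ℓ) → Bool => F c = u).card : ℝ) := by rw [natCast_card_filter]
    rw [hA, hB]
    have h3 := three_mul_card_tau_le t₀ η hη t
    have hpos : (0 : ℝ) ≤ ((univ.filter fun c : Fin (K * ℓ) → Bool => F c = u).card : ℝ) := by positivity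
    nlinarith
  have herr : ∀ a ∈ (univ : Finset (Fin K → Bool)).erase (fun _ => false),
      (∑ q, f q * CubeDistr.chi a q) * ∑ c : Fin (K * ℓ) → Bool, (if F c = u then (1 : ℝ) else 0) * CubeDistr.chi a (bpar (ℓ := ℓ) c)
        ≤ (2 : ℝ) ^ K * (2 * D * (2 : ℝ) ^ (K * ℓ) / Real.sqrt ℓ) := by
    intro a ha
    have ha0 : a ≠ fun _ => false := (mem_erase.1 ha).1
    have hX : |∑ c : Fin (K * ℓ) → Bool, (if F c = u then (1 : ℝ) else 0) * CubeDistr.chi a (bpar (ℓ := ℓ) c)| ≤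
        2 * D * (2 : ℝ) ^ (K * ℓ) / Real.sqrt ℓ := by
      simp_rw [chi_bpar_eq]
      -- the union of the selected blocks is non-empty
      have hne : 1 ≤ (univ.filter fun j => a j = true).card := by
        rw [Nat.one_le_iff_ne_zero, Ne, Finset.card_eq_zero, Finset.filter_eq_empty_iff]
        intro h
        apply ha0; funext j; simpa using h (mem_univ j)
      have hT : 1 ≤ (blockUnion (ℓ := ℓ) a).card := by rw [card_blockUnion]; nlinarith
      have hTN : (blockUnion (ℓ := ℓ) a).card ≤ K * ℓ := by
        have := Finset.card_le_univ (blockUnion (ℓ := ℓ) a); rwa [Fintype.card_fin] at this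
      refine le_trans (abs_signed_corr_le hF u _ hT) ?_
      have hc := choose_half_mul_pow_le hT hTN
      have hsq : Real.sqrt ℓ ≤ Real.sqrt (blockUnion (ℓ := ℓ) a).card := by
        apply Real.sqrt_le_sqrt
        rw [card_blockUnion]; push_cast
        have : (1 : ℝ) ≤ (univ.filter fun j => a j = true).card := by exact_mod_cast hne
        have hl : (0 : ℝ) ≤ ℓ := by positivity
        nlinarith
      have hℓpos : 0 < Real.sqrt ℓ := Real.sqrt_pos.2 (by exact_mod_cast hℓ)
      calc 2 * (D : ℝ) * ((blockUnion (ℓ := ℓ) a).card.choose ((blockUnion (ℓ := ℓ) a).card / 2)) *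
            2 ^ (K * ℓ - (blockUnion (ℓ := ℓ) a).card)
          = 2 * D * (((blockUnion (ℓ := ℓ) a).card.choose ((blockUnion (ℓ := ℓ) a).card / 2) : ℝ) *
              2 ^ (K * ℓ - (blockUnion (ℓ := ℓ) a).card)) := by ring
        _ ≤ 2 * D * (2 ^ (K * ℓ) / Real.sqrt (blockUnion (ℓ := ℓ) a).card) :=
            mul_le_mul_of_nonneg_left hc (by positivity)
        _ ≤ 2 * D * (2 ^ (K * ℓ) / Real.sqrt ℓ) := by
            apply mul_le_mul_of_nonneg_left _ (by positivity)
            exact div_le_div_of_nonneg_left (by positivity) hℓpos hsq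
        _ = 2 * D * (2 : ℝ) ^ (K * ℓ) / Real.sqrt ℓ := by ring
    have hW := abs_walsh_coeff_le f hf01 a
    calc _ ≤ |(∑ q, f q * CubeDistr.chi a q)| * |∑ c : Fin (K * ℓ) → Bool, (if F c = u then (1 : ℝ) else 0) *
            CubeDistr.chi a (bpar (ℓ := ℓ) c)| := by rw [← abs_mul]; exact le_abs_self _
      _ ≤ (2 : ℝ) ^ K * (2 * D * (2 : ℝ) ^ (K * ℓ) / Real.sqrt ℓ) :=
          mul_le_mul hW hX (abs_nonneg _) (by positivity)
  have hsum := Finset.sum_le_sum herr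
  rw [sum_const, nsmul_eq_mul] at hsum
  have hcardE : (((univ : Finset (Fin K → Bool)).erase (fun _ => false)).card : ℝ) ≤ (2 : ℝ) ^ K := by
    have : ((univ : Finset (Fin K → Bool)).erase (fun _ => false)).card ≤ 2 ^ K := by
      calc _ ≤ (univ : Finset (Fin K → Bool)).card := card_erase_le
        _ = 2 ^ K := by simp
    exact_mod_cast this
  have h2K : (0 : ℝ) < (2 : ℝ) ^ K := by positivity
  have hE0 : (0 : ℝ) ≤ (2 : ℝ) ^ K * (2 * D * (2 : ℝ) ^ (K * ℓ) / Real.sqrt ℓ) := by positivity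
  calc (1 / (2 : ℝ) ^ K) * ((∑ q, f q * CubeDistr.chi (fun _ : Fin K => false) q) *
        ∑ c : Fin (K * ℓ) → Bool, (if F c = u then (1 : ℝ) else 0) * CubeDistr.chi (fun _ => false) (bpar (ℓ := ℓ) c) +
        ∑ a ∈ (univ : Finset (Fin K → Bool)).erase (fun _ => false), (∑ q, f q * CubeDistr.chi a q) *
          ∑ c : Fin (K * ℓ) → Bool, (if F c = u then (1 : ℝ) else 0) * CubeDistr.chi a (bpar (ℓ := ℓ) c))
      ≤ (1 / (2 : ℝ) ^ K) * ((2 ^ K + 2) / 3 * ((univ.filter fun c : Fin (K * ℓ) → Bool => F c = u).card : ℝ) +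
          (2 : ℝ) ^ K * ((2 : ℝ) ^ K * (2 * D * (2 : ℝ) ^ (K * ℓ) / Real.sqrt ℓ))) := by
        apply mul_le_mul_of_nonneg_left _ (by positivity)
        exact add_le_add hmain (le_trans hsum (mul_le_mul_of_nonneg_right hcardE hE0))
    _ = _ := by field_simp


/-- **LEMMA S for three hypotheses** (ROUND-15 §3.6): if the `0/1`-valued `F_t` (degree `≤ D`) fire at most twice at
every point, then `Σ_t #{c : F_t c = 1 ∧ τ(p(c)) = t} ≤ 2^{Kℓ}·(2/3 + (4/3)·2^{−K} + 6·2^K·D/√ℓ)`. -/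
theorem sum_three_le (hℓ : 1 ≤ ℓ) (t₀ : ZMod 3) (η : Fin K → ZMod 3) (hη : ∀ j, η j ≠ 0) {D : ℕ}
    (F : ZMod 3 → CubeFn (ZMod 3) (K * ℓ)) (hF : ∀ t, F t ∈ lowDeg (ZMod 3) (K * ℓ) D)
    (hcharge : ∀ c : Fin (K * ℓ) → Bool, (univ.filter fun t : ZMod 3 => F t c = 1).card ≤ 2) :
    ∑ t : ZMod 3, ((univ.filter fun c : Fin (K * ℓ) → Bool => F t c = 1 ∧ target t₀ η c = t).card : ℝ) ≤
      (2 : ℝ) ^ (K * ℓ) * (2 / 3 + 4 / 3 / (2 : ℝ) ^ K + 6 * (2 : ℝ) ^ K * D / Real.sqrt ℓ) := by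
  -- each count as a sum of products of indicators
  have hcount : ∀ t : ZMod 3, ((univ.filter fun c : Fin (K * ℓ) → Bool => F t c = 1 ∧ target t₀ η c = t).card : ℝ) =
      ∑ c : Fin (K * ℓ) → Bool, (if F t c = 1 then (1 : ℝ) else 0) *
        (if tau t₀ η (bpar (ℓ := ℓ) c) = t then 1 else 0) := by
    intro t
    rw [natCast_card_filter]
    refine Finset.sum_congr rfl fun c _ => ?_
    simp only [target]
    by_cases h1 : F t c = 1 <;> by_cases h2 : tau t₀ η (bpar (ℓ := ℓ) c) = t <;> simp [h1, h2]
  simp only [hcount]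
  -- the pointwise budget: `Σ_t #{F_t = 1} ≤ 2·2^{Kℓ}`
  have hbudget : ∑ t : ZMod 3, ((univ.filter fun c : Fin (K * ℓ) → Bool => F t c = 1).card : ℝ) ≤
      2 * (2 : ℝ) ^ (K * ℓ) := by
    have h : ∑ t : ZMod 3, ((univ.filter fun c : Fin (K * ℓ) → Bool => F t c = 1).card : ℝ) =
        ∑ c : Fin (K * ℓ) → Bool, ((univ.filter fun t : ZMod 3 => F t c = 1).card : ℝ) := by
      simp only [natCast_card_filter]
      rw [Finset.sum_comm]
    rw [h]
    calc ∑ c : Fin (K * ℓ) → Bool, ((univ.filter fun t : ZMod 3 => F t c = 1).card : ℝ)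
        ≤ ∑ _c : Fin (K * ℓ) → Bool, (2 : ℝ) := Finset.sum_le_sum fun c _ => by exact_mod_cast hcharge c
      _ = 2 * (2 : ℝ) ^ (K * ℓ) := by
          rw [sum_const, card_univ, Fintype.card_fun, Fintype.card_bool, Fintype.card_fin, nsmul_eq_mul]
          push_cast; ring
  calc ∑ t : ZMod 3, ∑ c : Fin (K * ℓ) → Bool, (if F t c = 1 then (1 : ℝ) else 0) *
        (if tau t₀ η (bpar (ℓ := ℓ) c) = t then 1 else 0)
      ≤ ∑ t : ZMod 3, ((2 ^ K + 2) / (3 * 2 ^ K) *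
          ((univ.filter fun c : Fin (K * ℓ) → Bool => F t c = 1).card : ℝ) +
          (2 : ℝ) ^ K * (2 * D * (2 : ℝ) ^ (K * ℓ) / Real.sqrt ℓ)) :=
        Finset.sum_le_sum fun t _ => sum_ind_mul_tau_le hℓ t₀ η hη (hF t) 1 t
    _ = (2 ^ K + 2) / (3 * 2 ^ K) * ∑ t : ZMod 3, ((univ.filter fun c : Fin (K * ℓ) → Bool => F t c = 1).card : ℝ) +
          3 * ((2 : ℝ) ^ K * (2 * D * (2 : ℝ) ^ (K * ℓ) / Real.sqrt ℓ)) := by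
        rw [Finset.sum_add_distrib, ← Finset.mul_sum, sum_const, card_univ, ZMod.card, nsmul_eq_mul]; norm_num
    _ ≤ (2 ^ K + 2) / (3 * 2 ^ K) * (2 * (2 : ℝ) ^ (K * ℓ)) +
          3 * ((2 : ℝ) ^ K * (2 * D * (2 : ℝ) ^ (K * ℓ) / Real.sqrt ℓ)) := by
        have hpos : (0 : ℝ) ≤ (2 ^ K + 2) / (3 * 2 ^ K) := by positivity
        nlinarith [hbudget]
    _ = (2 : ℝ) ^ (K * ℓ) * (2 / 3 + 4 / 3 / (2 : ℝ) ^ K + 6 * (2 : ℝ) ^ K * D / Real.sqrt ℓ) := by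
        field_simp
        ring

end BlockParity

end Summit.QuantumAdvantage.AdviceFreeQNC0

end
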